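import Literature.Barriers.CriticalPhenomena.LaceExpansionEtaZeroXSpaceNumerics
import Literature.Barriers.CriticalPhenomena.LaceExpansionPcSubcritLargeDHolds
import HarnessLib

/-!
# `η = 0` in `x`-space, ONE dimension at a time, and for all sufficiently large `d` modulo
# `HvdH2017_prop88` and Lemma 1.5 (Hara 2008, Thm. 1.1 as printed: "`d ≥ 19` … say `d ≥ 30`")

Barrier catalogue `Literature/Barriers/CriticalPhenomena/` (D-0021), continuation of
`LaceExpansionEtaZeroXSpaceNumerics.lean` (Hara's `x`-space reduction with the PROVED
`T̄^{(0,β)}`-variant of Lemma 1.6) and `LaceExpansionPcSubcritLargeDHolds.lean` (Prop. 1.2 at `p_c`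
for all large `d` from `HvdH2017_prop88`). The assemblies of the catalogue so far conclude the
named fact `Hara2008_etaZeroXSpace : ∀ d ≥ 11, EtaZeroXSpace d` (Heydenreich–van der Hofstad,
Thm. 11.4) from named facts quantified over all `d ≥ 11`, two of which carry, for `11 ≤ d ≤ 18`,
content that is not in print (Fitzner–van der Hofstad's numerics and Hara's unpublished
improvement; see `LaceExpansionXSpaceTriangleNumerics.lean`). Hara's own theorem is a LARGE-`d`
statement ("for the nearest-neighbour model with `d ≥ 19`"; the text is complete "only … for large
`d` (say `d ≥ 30`)", §1.2), and every step of its proof is now a theorem of the tree for ONE `d`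
except (a) the successful bootstrap of Heydenreich–van der Hofstad, Prop. 8.8 (`HvdH2017_prop88`,
open: Prop. 8.10) and (b) the two-long-lines estimate of §3.5 (Lemma 1.5). This file therefore
re-runs the reduction for ONE dimension `d ≥ 11`, with per-`d` hypotheses:

* `piMoment_stepAt`, `piMoment_iterateAt`, `haraGBar_lt_top_at` — the recursion of §1.2.4 at `d`
  from the `T̄^{(0,β)}`-variant of Lemma 1.6 AT `d` (`h16`) and Lemma 1.7 (`Hara2008_lemma17Pc_holds`);
* `xSpacePiBound_of_haraGBar_at` — steps 2–4 (`Ḡ^{(d-17/4)} < ∞`, Lemma 1.5 AT `d` (`h15`), the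
  Gaussian lemma `Hara2008_gaussianConvolution_holds`, Lemma 1.5 again);
* `etaZeroXSpace_of_coefficient` — `EtaZeroXSpace d` from a lace-expansion coefficient at `p_c`
  with the `x`-space bound `|Π(x)| ≤ c⟦x⟧^{-2(d-2)}` (the proof of `etaZeroXSpace_of_framework`,
  `LaceExpansionXSpaceAsymptotics.lean`, for one `d`);
* `lemma16TAt_of_KB_lt_one` — the `T̄^{(0,β)}`-variant of Lemma 1.6 at `d` from
  `2Δ̃_{p_c}Δ_{p_c} < 1` (`LaceExpansionXSpaceWeightedNLoop.lean`);
* `etaZeroXSpace_at_of_inputs` — **`EtaZeroXSpace d` (`d ≥ 11`) from: a coefficient at `p_c`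
  with finite second moment (Prop. 1.2 at `p_c` for this `d`), Lemma 1.5 for this `d`, and
  `2Δ̃_{p_c}Δ_{p_c} < 1`**;
* `exists_etaZeroXSpace_largeD` — **`∃ d₀, ∀ d ≥ d₀, EtaZeroXSpace d` from `HvdH2017_prop88` and
  Lemma 1.5 for all large `d`** (`exists_isLaceCoefficientPc_largeD_of_prop88`,
  `two_mul_percTriTildeBar_mul_percTriBar_lt_one_of_prop88`); `exists_etaZeroXSpace_largeD_of_lemma15Pc`
  — the same with the named fact `Hara2008_lemma15Pc` for Lemma 1.5;
* `lemma15At_of_twoLongLinesAt`, `exists_etaZeroXSpace_largeD_of_twoLongLinesAt` — Lemma 1.5 at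
  `d` from the two-long-lines bound at `d` (the body of `Hara2008_twoLongLinesDiagramBoundPc` at
  `d`), and **`∃ d₀, ∀ d ≥ d₀, EtaZeroXSpace d` from `HvdH2017_prop88` and the two-long-lines
  bound for all large `d`**.

## References

* T. Hara, Ann. Probab. 36 (2008) 530–593 (arXiv:math-ph/0504021): Thm. 1.1 ("`d ≥ 19`"), §1.2
  ("only … for large `d` (say `d ≥ 30`)"), Prop. 1.2, Lemmas 1.5–1.7, §1.2.3–§1.2.4, §3.4–§3.5.
* M. Heydenreich, R. van der Hofstad, *Progress in High-Dimensional Percolation and Random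
  Graphs*, Springer 2017: Thm. 11.4 and pp. 137–139; Prop. 7.4, Prop. 8.8, Cor. 8.13.
-/

noncomputable section

namespace Literature.Barriers.CriticalPhenomena

open _root_.MeasureTheory _root_.Filter _root_.Topology Literature.Probability.LatticeModels
  Literature.Probability.Percolation

open scoped ENNReal

variable {d : ℕ}

/-! ### The recursion of §1.2.4 for one `d` -/

/-- **One step of the recursion at `d`** from the `T̄^{(0,β)}`-variant of Lemma 1.6 at `d` and
Lemma 1.7 (the proof of `piMoment_stepT`). [cite: Hara2008, §1.2.4 (the recursion with β_{i+1} = 2) and Lemma 1.7] -/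
theorem piMoment_stepAt (hd : 11 ≤ d)
    (h16 : ∀ Φ : Site d → ℝ, IsLaceCoefficientPc d Φ →
      ∀ β γ : ℝ, 0 ≤ β → 0 ≤ γ → haraWBar d β γ < ⊤ → haraTBar d 0 γ < ⊤ → haraTBar d 0 β < ⊤ →
        Summable fun x : Site d => euclidNorm x ^ (β + γ) * |Φ x|)
    {Φ : Site d → ℝ} (hΦ : IsLaceCoefficientPc d Φ) {φ : ℝ} {n : ℤ}
    (hn : ⌊φ⌋ = n) (hn2 : 2 ≤ n) (hnd : n ≤ (d : ℤ) - 6)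
    (hmom : Summable fun x : Site d => euclidNorm x ^ φ * |Φ x|) :
    Summable fun x : Site d => euclidNorm x ^ ((n : ℝ) + 7 / 4) * |Φ x| := by
  have hdR : (11 : ℝ) ≤ d := by exact_mod_cast hd
  have hn2R : (2 : ℝ) ≤ n := by exact_mod_cast hn2
  have hnle : ((n : ℤ) : ℝ) ≤ φ := hn ▸ Int.floor_le φ
  obtain ⟨-, hW, hT, -, -⟩ := Hara2008_lemma17Pc_holds d hd Φ hΦ φ (by linarith) hmom
  have hnφ : ((⌊φ⌋ : ℤ) : ℝ) = n := by rw [hn]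
  have hndR : (n : ℝ) ≤ d - 6 := by
    have : ((n : ℤ) : ℝ) ≤ ((d : ℤ) - 6 : ℤ) := by exact_mod_cast hnd
    push_cast at this
    exact this
  set γ : ℝ := (n : ℝ) - 1 / 4 with hγ
  have hγ0 : 0 ≤ γ := by rw [hγ]; linarith
  have hγodd : ¬ IsOddInt γ := not_isOddInt_int_sub (by norm_num) (by norm_num)
  have hγfloor : (⌊γ⌋ : ℝ) = n - 1 := by
    rw [hγ, floor_int_sub (by norm_num) (by norm_num)]
    push_cast
    ring
  have h2floor : (⌊(2 : ℝ)⌋ : ℝ) = 2 := by norm_num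
  have h0floor : (⌊(0 : ℝ)⌋ : ℝ) = 0 := by norm_num
  have hW' : haraWBar d 2 γ < ⊤ := by
    refine hW 2 γ (by norm_num) hγ0 not_isOddInt_two hγodd ?_ ?_ ?_ ?_
    · rw [hnφ]; exact hn2R
    · rw [hnφ, hγ]; linarith
    · rw [hγ]; linarith
    · rw [h2floor, hγfloor, hγ]; linarith
  have hT' : haraTBar d 0 γ < ⊤ := by
    refine hT 0 γ le_rfl hγ0 not_isOddInt_zero hγodd ?_ ?_ ?_ ?_
    · rw [hnφ]; linarith
    · rw [hnφ, hγ]; linarith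
    · rw [hγ]; linarith
    · rw [h0floor, hγfloor, hγ]; linarith
  have hT2 : haraTBar d 0 2 < ⊤ := by
    refine hT 0 2 le_rfl (by norm_num) not_isOddInt_zero not_isOddInt_two ?_ ?_ ?_ ?_
    · rw [hnφ]; linarith
    · rw [hnφ]; exact hn2R
    · linarith
    · rw [h0floor, h2floor]; norm_num
  have h := h16 Φ hΦ 2 γ (by norm_num) hγ0 hW' hT' hT2
  refine h.congr fun x => ?_
  rw [hγ]
  congr 2
  ring

/-- **The recursion at `d`, iterated**: `Σ_x |x|^{n+3/4}|Π(x)| < ∞` for `3 ≤ n ≤ d - 5`.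
[cite: Hara2008, §1.2.4 (proof for percolation)] -/
theorem piMoment_iterateAt (hd : 11 ≤ d)
    (h16 : ∀ Φ : Site d → ℝ, IsLaceCoefficientPc d Φ →
      ∀ β γ : ℝ, 0 ≤ β → 0 ≤ γ → haraWBar d β γ < ⊤ → haraTBar d 0 γ < ⊤ → haraTBar d 0 β < ⊤ →
        Summable fun x : Site d => euclidNorm x ^ (β + γ) * |Φ x|)
    {Φ : Site d → ℝ} (hΦ : IsLaceCoefficientPc d Φ)
    (hmom : Summable fun x : Site d => euclidNorm x ^ 2 * |Φ x|) :
    ∀ n : ℕ, 3 ≤ n → n ≤ d - 5 →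
      Summable fun x : Site d => euclidNorm x ^ ((n : ℝ) + 3 / 4) * |Φ x| := by
  intro n hn3 hnd
  induction n, hn3 using Nat.le_induction with
  | base =>
    have hmom' : Summable fun x : Site d => euclidNorm x ^ (2 : ℝ) * |Φ x| := by
      refine hmom.congr fun x => ?_
      rw [show (2 : ℝ) = ((2 : ℕ) : ℝ) by norm_num, Real.rpow_natCast]
    have h := piMoment_stepAt hd h16 hΦ (φ := 2) (n := 2) (by norm_num) le_rfl (by omega) hmom'
    refine h.congr fun x => ?_
    norm_num
  | succ n hn3 ih =>
    have ih' := ih (by omega)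
    have hfloor : ⌊(n : ℝ) + 3 / 4⌋ = (n : ℤ) := by
      rw [Int.floor_eq_iff]
      push_cast
      constructor <;> linarith
    have h := piMoment_stepAt hd h16 hΦ hfloor (by omega) (by omega) ih'
    refine h.congr fun x => ?_
    push_cast
    ring_nf

/-- **Output of the recursion at `d`**: `Ḡ^{(d-17/4)} < ∞` (Lemma 1.7 with `φ = α = d - 4 - 1/4`).
[cite: Hara2008, §1.2.4 (proof for percolation)] -/
theorem haraGBar_lt_top_at (hd : 11 ≤ d)
    (h16 : ∀ Φ : Site d → ℝ, IsLaceCoefficientPc d Φ →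
      ∀ β γ : ℝ, 0 ≤ β → 0 ≤ γ → haraWBar d β γ < ⊤ → haraTBar d 0 γ < ⊤ → haraTBar d 0 β < ⊤ →
        Summable fun x : Site d => euclidNorm x ^ (β + γ) * |Φ x|)
    {Φ : Site d → ℝ} (hΦ : IsLaceCoefficientPc d Φ)
    (hmom : Summable fun x : Site d => euclidNorm x ^ 2 * |Φ x|) :
    haraGBar d ((d : ℝ) - 17 / 4) < ⊤ := by
  have hdR : (11 : ℝ) ≤ d := by exact_mod_cast hd
  have h := piMoment_iterateAt hd h16 hΦ hmom (d - 5) (by omega) le_rfl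
  have hcast : (((d - 5 : ℕ) : ℝ) + 3 / 4) = (d : ℝ) - 17 / 4 := by
    rw [Nat.cast_sub (by omega)]
    push_cast
    ring
  rw [hcast] at h
  obtain ⟨hG, -, -, -, -⟩ := Hara2008_lemma17Pc_holds d hd Φ hΦ ((d : ℝ) - 17 / 4) (by linarith) h
  refine hG ((d : ℝ) - 17 / 4) (by linarith) ?_ le_rfl (by linarith)
  have : (d : ℝ) - 17 / 4 = (((d : ℤ) - 4 : ℤ) : ℝ) - 1 / 4 := by push_cast; ring
  rw [this]
  exact not_isOddInt_int_sub (by norm_num) (by norm_num)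

/-! ### Steps 2–4 for one `d`, with Lemma 1.5 at `d` -/

/-- **Hara's `x`-space reduction at `d` from `Ḡ^{(d-17/4)} < ∞` and Lemma 1.5 AT `d`** (the proof
of `xSpacePiBound_of_haraGBar`, with the Gaussian lemma `Hara2008_gaussianConvolution_holds`).
[cite: Hara2008, §1.2.3 (Lemma 1.5, the two passes) and §1.2.4 (the recursion, "d > 10")] -/
theorem xSpacePiBound_of_haraGBar_at (hd : 11 ≤ d) {Φ : Site d → ℝ} (hΦ : IsLaceCoefficientPc d Φ)
    (hGbar : haraGBar d ((d : ℝ) - 17 / 4) < ⊤)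
    (h15 : ∀ Φ : Site d → ℝ, IsLaceCoefficientPc d Φ →
      ∀ α : ℝ, 0 < α → α < d → ∃ c : ℝ, ∀ β : ℝ, 0 < β →
        (∀ x : Site d, tau d (criticalProbI d) 0 x ≤ β / jnorm x ^ α) →
          ∀ x : Site d, x ≠ 0 → |Φ x| ≤ c * β ^ 2 / jnorm x ^ (2 * α)) :
    ∃ c : ℝ, ∀ x : Site d, |Φ x| ≤ c / jnorm x ^ (2 * ((d : ℝ) - 2)) := by
  have hdR : (11 : ℝ) ≤ d := by exact_mod_cast hd
  have hd1 : 1 ≤ d := by omega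
  have hd3 : 3 ≤ d := by omega
  set p : ℝ := (criticalProbI d : ℝ) with hp
  set g := laceSource Φ with hg_def
  set J := laceKernel p Φ with hJ_def
  set α₀ : ℝ := (d : ℝ) - 17 / 4 with hα₀
  obtain ⟨β₀, hβ₀, hτ₀⟩ := tau_le_of_haraGBar_lt_top hGbar
  obtain ⟨c₀, hc₀⟩ := h15 Φ hΦ α₀ (by rw [hα₀]; linarith) (by rw [hα₀]; linarith)
  set s : ℝ := 2 * α₀ with hs
  have hΦ₀ : ∀ x, |Φ x| ≤ max (c₀ * β₀ ^ 2) |Φ 0| / jnorm x ^ s :=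
    decay_of_decay_ne_zero fun x hx => hc₀ β₀ hβ₀ hτ₀ x hx
  set C₀ : ℝ := max (c₀ * β₀ ^ 2) |Φ 0| with hC₀
  have hC₀nn : 0 ≤ C₀ := le_max_of_le_right (abs_nonneg _)
  have hsnn : 0 ≤ s := by rw [hs, hα₀]; linarith
  set ρ : ℝ := ((d : ℝ) - 21 / 2) / 2 with hρ
  have hρpos : 0 < ρ := by rw [hρ]; linarith
  have hgb : ∀ x, |g x| ≤ (1 + C₀) / jnorm x ^ s := abs_laceSource_le hΦ₀
  have hJb : ∀ y, |J y| ≤ (2 * d * |p| * (2 ^ s * (1 + C₀))) / jnorm y ^ s :=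
    abs_laceKernel_le hΦ₀ hsnn p
  set CJ : ℝ := 2 * d * |p| * (2 ^ s * (1 + C₀)) with hCJ
  have hCJnn : 0 ≤ CJ := by positivity
  have hsd : (d : ℝ) + 2 + ρ ≤ s := by rw [hs, hα₀, hρ]; linarith
  have hg_abs : Summable fun x => |g x| := summable_abs_of_decay hgb (by rw [hs, hα₀]; linarith)
  have hJ2 : Summable fun x => euclidNorm x ^ (2 : ℝ) * |J x| :=
    summable_rpow_mul_abs_of_decay hJb (by norm_num) (by rw [hs, hα₀]; linarith)
  have hJ2' : Summable fun x => euclidNorm x ^ 2 * |J x| := by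
    refine hJ2.congr fun x => ?_
    rw [show (2 : ℝ) = ((2 : ℕ) : ℝ) by norm_num, Real.rpow_natCast]
  have hJρ : Summable fun x => euclidNorm x ^ (2 + ρ) * |J x| :=
    summable_rpow_mul_abs_of_decay hJb (by linarith) (by rw [hs, hα₀, hρ]; linarith)
  obtain ⟨c₁, hc₁, hlow⟩ := hΦ.lower
  have hK₁ : 0 < ∑' x, euclidNorm x ^ 2 * J x :=
    secondMoment_pos_of_lower' hd1 hΦ.hasSum_one hJ2' hc₁ hlow
  have hKer : HaraKernelHyp d J ρ :=
    { symm := isZdSymmetric_laceKernel hΦ.symm p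
      rho_pos := hρpos
      hasSum_one := hΦ.hasSum_one
      lower := ⟨2 * c₁, by positivity, fun k hk => by
        have h := hlow k hk
        calc 2 * c₁ * (∑ i, k i ^ 2) / (2 * d) = c₁ * (∑ i, k i ^ 2) / d := by
              field_simp
          _ ≤ _ := h⟩
      secondMoment_pos := hK₁
      summable_sq := hJ2'
      decay := ⟨CJ, fun x => (hJb x).trans (div_jnorm_rpow_mono hCJnn (by linarith))⟩
      summable_rho := hJρ
      decay_rho := ⟨CJ, fun x => (hJb x).trans (div_jnorm_rpow_mono hCJnn hsd)⟩ }
  have hSrc : HaraSourceHyp d g ρ :=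
    { symm := isZdSymmetric_laceSource hΦ.symm
      summable := hg_abs
      decay := ⟨1 + C₀, fun x =>
        (hgb x).trans (div_jnorm_rpow_mono (by linarith) (by linarith))⟩
      decay_rho := ⟨1 + C₀, fun x =>
        (hgb x).trans (div_jnorm_rpow_mono (by linarith) (by linarith))⟩ }
  obtain ⟨-, K, R, hKR⟩ := Hara2008_gaussianConvolution_holds d hd3 J g ρ hKer hSrc
  set M : ℝ := (∑' y, g y) / (∑' y, euclidNorm y ^ 2 * J y) * gaussianAmp d with hM
  have hasym : ∀ x : Site d, R ≤ euclidNorm x →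
      |tau d (criticalProbI d) 0 x - M * euclidNorm x ^ (2 - (d : ℝ))| ≤
        K * euclidNorm x ^ (-((d : ℝ) - 2 + min ρ 2 / d)) := by
    intro x hx
    have h := hKR x hx
    rw [← hΦ.repr x, ← Complex.ofReal_sub, Complex.norm_real, Real.norm_eq_abs] at h
    exact h
  obtain ⟨β₁, hβ₁, hτ₁⟩ := tau_le_jnorm_of_asymptotics (by omega) (by positivity) hasym
  obtain ⟨c₂, hc₂⟩ := h15 Φ hΦ ((d : ℝ) - 2) (by linarith) (by linarith)
  refine ⟨max (c₂ * β₁ ^ 2) |Φ 0|, fun x => ?_⟩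
  exact decay_of_decay_ne_zero (fun x hx => hc₂ β₁ hβ₁ hτ₁ x hx) x

/-! ### `η = 0` at `d` from a coefficient with the `x`-space bound -/

/-- **`EtaZeroXSpace d` from a lace-expansion coefficient at `p_c` with
`|Π(x)| ≤ c⟦x⟧^{-2(d-2)}`** (`d ≥ 11`): the proof of `etaZeroXSpace_of_framework`
(`LaceExpansionXSpaceAsymptotics.lean`) for one `d`, with Cor. 1.4 supplied by
`Hara2008_gaussianConvolution_holds` — `|J|, |g| ≤ c'⟦x⟧^{-(d+2+ρ)}` with `ρ = d - 6 ≥ 2`, the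
moment conditions, `K₁ > 0`, `Σ g = 1/(2dp_c) > 0`, and the conclusion of Cor. 1.4 with
`(ρ ∧ 2)/d = 2/d`. [cite: Hara2008, §1.2.2–§1.2.3]
[cite: HeydenreichVanDerHofstad2017, Thm. 11.4 (11.2.3) and (11.2.13)–(11.2.15)] -/
theorem etaZeroXSpace_of_coefficient (hd : 11 ≤ d) {Φ : Site d → ℝ} (hΦL : IsLaceCoefficientPc d Φ)
    (hX : ∃ c : ℝ, ∀ x : Site d, |Φ x| ≤ c / jnorm x ^ (2 * ((d : ℝ) - 2))) : EtaZeroXSpace d := by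
  obtain ⟨c, hΦ⟩ := hX
  have hΦsymm := hΦL.symm
  have hJ1 := hΦL.hasSum_one
  obtain ⟨c₁, hc₁, hlow⟩ := hΦL.lower
  have hτ := hΦL.repr
  set p : ℝ := (criticalProbI d : ℝ) with hp
  set g := laceSource Φ with hg_def
  set J := laceKernel p Φ with hJ_def
  have hd3 : 3 ≤ d := by omega
  have hd1 : 1 ≤ d := by omega
  have hdR : (11 : ℝ) ≤ d := by exact_mod_cast hd
  set s₀ : ℝ := 2 * ((d : ℝ) - 2) with hs₀
  have hs₀nn : 0 ≤ s₀ := by rw [hs₀]; linarith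
  have hc0 : 0 ≤ c := by simpa using (abs_nonneg _).trans (hΦ 0)
  have hgb : ∀ x, |g x| ≤ (1 + c) / jnorm x ^ s₀ := abs_laceSource_le hΦ
  have hJb : ∀ y, |J y| ≤ (2 * d * |p| * (2 ^ s₀ * (1 + c))) / jnorm y ^ s₀ :=
    abs_laceKernel_le hΦ hs₀nn p
  set CJ : ℝ := 2 * d * |p| * (2 ^ s₀ * (1 + c)) with hCJ
  have hCJnn : 0 ≤ CJ := by positivity
  have hg_abs : Summable fun x => |g x| := summable_abs_of_decay hgb (by rw [hs₀]; linarith)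
  have hg_sum : Summable g := summable_abs_iff.1 hg_abs
  have hJ2 : Summable fun x => euclidNorm x ^ (2 : ℝ) * |J x| :=
    summable_rpow_mul_abs_of_decay hJb (by norm_num) (by rw [hs₀]; linarith)
  have hJ4 : Summable fun x => euclidNorm x ^ (4 : ℝ) * |J x| :=
    summable_rpow_mul_abs_of_decay hJb (by norm_num) (by rw [hs₀]; linarith)
  have hJ2' : Summable fun x => euclidNorm x ^ 2 * |J x| := by
    refine hJ2.congr fun x => ?_
    rw [show (2 : ℝ) = ((2 : ℕ) : ℝ) by norm_num, Real.rpow_natCast]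
  have hJ4' : Summable fun x => (euclidNorm x ^ 2) ^ 2 * |J x| := by
    refine hJ4.congr fun x => ?_
    rw [show (4 : ℝ) = ((4 : ℕ) : ℝ) by norm_num, Real.rpow_natCast]
    ring
  have hK₁ : 0 < ∑' x, euclidNorm x ^ 2 * J x :=
    secondMoment_pos_of_lower hd1 hJ1 hJ2' hJ4' hc₁ hlow
  have hp_pos : 0 < p := by
    rw [hp, coe_criticalProbI]
    exact criticalProb_zd_pos d hd1
  have hSg : 2 * d * p * ∑' x, g x = 1 := tsum_laceSource_eq hg_sum hJ1
  have hSg_pos : 0 < ∑' x, g x := by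
    by_contra hle
    have hle' : ∑' x, g x ≤ 0 := not_lt.1 hle
    have h2dp : 0 < 2 * (d : ℝ) * p := by positivity
    nlinarith
  have hKer : HaraKernelHyp d J 2 :=
    { symm := isZdSymmetric_laceKernel hΦsymm p
      rho_pos := two_pos
      hasSum_one := hJ1
      lower := ⟨2 * c₁, by positivity, fun k hk => by
        have h := hlow k hk
        calc 2 * c₁ * (∑ i, k i ^ 2) / (2 * d) = c₁ * (∑ i, k i ^ 2) / d := by
              field_simp
          _ ≤ _ := h⟩
      secondMoment_pos := hK₁
      summable_sq := hJ2'
      decay := ⟨CJ, fun x => (hJb x).trans (div_jnorm_rpow_mono hCJnn (by rw [hs₀]; linarith))⟩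
      summable_rho := by
        refine hJ4.congr fun x => ?_
        norm_num
      decay_rho := ⟨CJ, fun x =>
        (hJb x).trans (div_jnorm_rpow_mono hCJnn (by rw [hs₀]; linarith))⟩ }
  have hSrc : HaraSourceHyp d g 2 :=
    { symm := isZdSymmetric_laceSource hΦsymm
      summable := hg_abs
      decay := ⟨1 + c, fun x =>
        (hgb x).trans (div_jnorm_rpow_mono (by linarith) (by rw [hs₀]; linarith))⟩
      decay_rho := ⟨1 + c, fun x =>
        (hgb x).trans (div_jnorm_rpow_mono (by linarith) (by rw [hs₀]; linarith))⟩ }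
  obtain ⟨-, K, R, hKR⟩ := Hara2008_gaussianConvolution_holds d hd3 J g 2 hKer hSrc
  set A₂ : ℝ := (∑' y, g y) / (∑' y, euclidNorm y ^ 2 * J y) * gaussianAmp d with hA₂_def
  have hA₂ : 0 < A₂ := mul_pos (div_pos hSg_pos hK₁) (gaussianAmp_pos hd3)
  refine ⟨A₂, K, max R 1, hA₂, fun x hx => ?_⟩
  have hxR : R ≤ euclidNorm x := (le_max_left _ _).trans hx
  have hx1 : 1 ≤ euclidNorm x := (le_max_right _ _).trans hx
  have hxpos : 0 < euclidNorm x := by linarith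
  have h := hKR x hxR
  rw [← hτ x, min_self, ← Complex.ofReal_sub, Complex.norm_real, Real.norm_eq_abs] at h
  have he : euclidNorm x ^ (-((d : ℝ) - 2 + 2 / d)) =
      euclidNorm x ^ ((2 : ℝ) - d) * euclidNorm x ^ ((-2 : ℝ) / d) := by
    rw [← Real.rpow_add hxpos]
    congr 1
    ring
  rw [he, ← mul_assoc] at h
  exact h

/-! ### The `T̄^{(0,β)}`-variant of Lemma 1.6 at `d` from `2Δ̃_{p_c}Δ_{p_c} < 1` -/

/-- **Lemma 1.6, `T̄^{(0,β)}`-variant, for ONE `d ≥ 11` from `2Δ̃_{p_c}Δ_{p_c} < 1`**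
(`weightedNLoopBound_of_small` and `summable_weight_mul_abs_of_weightedBound` with the theorem
`HvdH2017_piNDiagramBoundPc_holds`). [cite: Hara2008, Lemma 1.6 and §3.4 (Steps 1–3 and Summary)]
[cite: HeydenreichVanDerHofstad2017, (7.4.10), Prop. 7.4 and Cor. 8.13] -/
theorem lemma16TAt_of_KB_lt_one (hd : 11 ≤ d) (hK : KB d < 1) :
    ∀ Φ : Site d → ℝ, IsLaceCoefficientPc d Φ →
      ∀ β γ : ℝ, 0 ≤ β → 0 ≤ γ → haraWBar d β γ < ⊤ → haraTBar d 0 γ < ⊤ → haraTBar d 0 β < ⊤ →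
        Summable fun x : Site d => euclidNorm x ^ (β + γ) * |Φ x| := by
  intro Φ hΦ β γ hβ hγ hW hT hTβ
  obtain ⟨c, ρ, hρ0, hρ1, hB⟩ := weightedNLoopBound_of_small hβ hγ hW hT hTβ hK
  exact summable_weight_mul_abs_of_weightedBound HvdH2017_piNDiagramBoundPc_holds hd hΦ hβ hγ hW
    hρ0 hρ1 hB

/-! ### The assemblies: one `d`, and all large `d` -/

/-- **`EtaZeroXSpace d` (`d ≥ 11`) from Prop. 1.2 at `p_c` for this `d`, Lemma 1.5 for this `d`,
and the smallness `2Δ̃_{p_c}Δ_{p_c} < 1`** — every other input of Hara's proof of Thm. 1.1 being a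
theorem of the tree (the Gaussian lemma, Lemma 1.7, the weighted `N`-loop estimate of §3.4 in the
`T̄^{(0,β)}`-variant, the bound (7.4.10) on the Hara–Slade coefficients, §1.2.2–§1.2.4).
[cite: Hara2008, Thm. 1.1 and §1.2 (framework of the proof)]
[cite: HeydenreichVanDerHofstad2017, Thm. 11.4 and pp. 137–139] -/
theorem etaZeroXSpace_at_of_inputs (hd : 11 ≤ d)
    (hP : ∃ Ψ : Site d → ℝ, IsLaceCoefficientPc d Ψ ∧ Summable fun x => euclidNorm x ^ 2 * |Ψ x|)
    (h15 : ∀ Φ : Site d → ℝ, IsLaceCoefficientPc d Φ →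
      ∀ α : ℝ, 0 < α → α < d → ∃ c : ℝ, ∀ β : ℝ, 0 < β →
        (∀ x : Site d, tau d (criticalProbI d) 0 x ≤ β / jnorm x ^ α) →
          ∀ x : Site d, x ≠ 0 → |Φ x| ≤ c * β ^ 2 / jnorm x ^ (2 * α))
    (hK : KB d < 1) : EtaZeroXSpace d := by
  obtain ⟨Ψ, hΨ, hmom⟩ := hP
  have hGbar := haraGBar_lt_top_at hd (lemma16TAt_of_KB_lt_one hd hK) hΨ hmom
  exact etaZeroXSpace_of_coefficient hd hΨ (xSpacePiBound_of_haraGBar_at hd hΨ hGbar h15)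

/-- **`η = 0` in `x`-space for all sufficiently large `d`, from `HvdH2017_prop88` and Lemma 1.5 for
all large `d`** — Hara 2008, Thm. 1.1, in its printed large-`d` form ("`d ≥ 19`"; text complete
"say `d ≥ 30`"), modulo (a) the successful bootstrap of Heydenreich–van der Hofstad, Prop. 8.8
(giving Prop. 1.2 at `p_c`, `exists_isLaceCoefficientPc_largeD_of_prop88`, and
`2Δ̃_{p_c}Δ_{p_c} < 1`, `two_mul_percTriTildeBar_mul_percTriBar_lt_one_of_prop88`) and (b) the
two-long-lines estimate of §3.5 in the form of Lemma 1.5 for every large `d`.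
[cite: Hara2008, Thm. 1.1, §1.2, Lemma 1.5 and §3.5]
[cite: HeydenreichVanDerHofstad2017, Prop. 8.8, Cor. 8.13 and Thm. 11.4] -/
theorem exists_etaZeroXSpace_largeD (h88 : HvdH2017_prop88)
    (h15 : ∃ d₁ : ℕ, ∀ d : ℕ, d₁ ≤ d → ∀ Φ : Site d → ℝ, IsLaceCoefficientPc d Φ →
      ∀ α : ℝ, 0 < α → α < d → ∃ c : ℝ, ∀ β : ℝ, 0 < β →
        (∀ x : Site d, tau d (criticalProbI d) 0 x ≤ β / jnorm x ^ α) →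
          ∀ x : Site d, x ≠ 0 → |Φ x| ≤ c * β ^ 2 / jnorm x ^ (2 * α)) :
    ∃ d₀ : ℕ, ∀ d : ℕ, d₀ ≤ d → EtaZeroXSpace d := by
  obtain ⟨dP, hP⟩ := exists_isLaceCoefficientPc_largeD_of_prop88 h88
  obtain ⟨dK, hK⟩ := two_mul_percTriTildeBar_mul_percTriBar_lt_one_of_prop88 h88
  obtain ⟨d₁, h15⟩ := h15
  refine ⟨max (max dP dK) (max d₁ 11), fun d hd => ?_⟩
  have hdP : dP ≤ d := le_trans (le_max_left _ _) (le_trans (le_max_left _ _) hd)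
  have hdK : dK ≤ d := le_trans (le_max_right _ _) (le_trans (le_max_left _ _) hd)
  have hd₁ : d₁ ≤ d := le_trans (le_max_left _ _) (le_trans (le_max_right _ _) hd)
  have hd11 : 11 ≤ d := le_trans (le_max_right _ _) (le_trans (le_max_right _ _) hd)
  exact etaZeroXSpace_at_of_inputs hd11 (hP d hdP) (h15 d hd₁) (hK d hdK)

/-- **`η = 0` in `x`-space for all sufficiently large `d`, from `HvdH2017_prop88` and the named
fact `Hara2008_lemma15Pc`** (Lemma 1.5 for `d ≥ 11`).
[cite: Hara2008, Thm. 1.1, §1.2 and Lemma 1.5] [cite: HeydenreichVanDerHofstad2017, Prop. 8.8 and Thm. 11.4] -/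
theorem exists_etaZeroXSpace_largeD_of_lemma15Pc (h88 : HvdH2017_prop88) (h15 : Hara2008_lemma15Pc) :
    ∃ d₀ : ℕ, ∀ d : ℕ, d₀ ≤ d → EtaZeroXSpace d :=
  exists_etaZeroXSpace_largeD h88 ⟨11, fun d hd => h15 d hd⟩

/-! ### Lemma 1.5 at `d` from the two-long-lines bound at `d` -/

/-- **Lemma 1.5 for ONE `d ≥ 11` from the two-long-lines bound on the diagrams at `d`** (the body
of `Hara2008_twoLongLinesDiagramBoundPc` at `d`) and the summability of the diagrams (which places
the Hara–Slade coefficients below them, `HvdH2017_piNDiagramBoundPc_holds`): the proofs of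
`exists_piTwoLongLines_of_diagramBounds` and `Hara2008_lemma15Pc_of_diagramBounds`
(`LaceExpansionXSpaceLemma15Diagrams.lean`) for one `d`, closed by step (iv)
`abs_le_of_piTwoLongLines`. [cite: Hara2008, Lemma 1.5 and §3.5 (closing paragraph)]
[cite: HeydenreichVanDerHofstad2017, (7.4.10) and Cor. 8.13] -/
theorem lemma15At_of_twoLongLinesAt (hd : 11 ≤ d)
    (hfin : (∑' N : ℕ, ∑' x : Site d, piNDiagramPc d N x) ≠ ⊤)
    (hL : ∃ C q : ℝ, 0 < q ∧ q < 1 ∧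
      ∀ (N : ℕ), 1 ≤ N → ∀ (x : Site d) (b : ℝ), x ≠ 0 →
        (∀ y : Site d, euclidNorm x / (2 * N + 1) - 1 ≤ euclidNorm y →
          tau d (criticalProbI d) 0 y ≤ b) →
        piNDiagramPc d N x ≤ ENNReal.ofReal (C * ((N : ℝ) + 1) ^ 2 * q ^ N * b ^ 2)) :
    ∀ Φ : Site d → ℝ, IsLaceCoefficientPc d Φ →
      ∀ α : ℝ, 0 < α → α < d → ∃ c : ℝ, ∀ β : ℝ, 0 < β →
        (∀ x : Site d, tau d (criticalProbI d) 0 x ≤ β / jnorm x ^ α) →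
          ∀ x : Site d, x ≠ 0 → |Φ x| ≤ c * β ^ 2 / jnorm x ^ (2 * α) := by
  intro Φ hΦ α hα _hαd
  obtain ⟨P, h0, hsum, hhas, hP0, hPN⟩ := HvdH2017_piNDiagramBoundPc_holds d hd hfin Φ hΦ
  obtain ⟨C, q, hq0, hq1, hB⟩ := hL
  have hbound : ∀ (N : ℕ) (x : Site d) (b : ℝ), x ≠ 0 →
      (∀ y : Site d, euclidNorm x / (2 * N + 1) - 1 ≤ euclidNorm y →
        tau d (criticalProbI d) 0 y ≤ b) →
      P N x ≤ max C 1 * ((N : ℝ) + 1) ^ 2 * q ^ N * b ^ 2 := by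
    intro N x b hx hb
    have hpoly : 0 ≤ ((N : ℝ) + 1) ^ 2 * q ^ N * b ^ 2 := by positivity
    rcases Nat.eq_zero_or_pos N with rfl | hN
    · have h1 : P 0 x ≤ b ^ 2 := (hP0 x).trans (piZeroBound_le_sq_of_far hx hb)
      have h2 : b ^ 2 ≤ max C 1 * (((0 : ℕ) : ℝ) + 1) ^ 2 * q ^ 0 * b ^ 2 := by
        rw [Nat.cast_zero, zero_add, one_pow, pow_zero, mul_one, mul_one]
        exact le_mul_of_one_le_left (sq_nonneg b) (le_max_right C 1)
      exact h1.trans h2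
    · have h1 : ENNReal.ofReal (P N x) ≤ ENNReal.ofReal (C * ((N : ℝ) + 1) ^ 2 * q ^ N * b ^ 2) :=
        (hPN N hN x).trans (hB N hN x b hx hb)
      refine (le_max_of_ofReal_le_ofReal (h0 N x) h1).trans (max_le ?_ ?_)
      · calc C * ((N : ℝ) + 1) ^ 2 * q ^ N * b ^ 2 = C * (((N : ℝ) + 1) ^ 2 * q ^ N * b ^ 2) := by ring
          _ ≤ max C 1 * (((N : ℝ) + 1) ^ 2 * q ^ N * b ^ 2) :=
              mul_le_mul_of_nonneg_right (le_max_left C 1) hpoly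
          _ = max C 1 * ((N : ℝ) + 1) ^ 2 * q ^ N * b ^ 2 := by ring
      · have hC : (0 : ℝ) ≤ max C 1 := le_trans zero_le_one (le_max_right C 1)
        calc (0 : ℝ) = max C 1 * 0 := (mul_zero _).symm
          _ ≤ max C 1 * (((N : ℝ) + 1) ^ 2 * q ^ N * b ^ 2) := mul_le_mul_of_nonneg_left hpoly hC
          _ = max C 1 * ((N : ℝ) + 1) ^ 2 * q ^ N * b ^ 2 := by ring
  exact abs_le_of_piTwoLongLines (le_trans zero_le_one (le_max_right C 1)) hq0.le hq1 h0
    (fun x => hsum.prod_symm.prod_factor x) (fun x => ((hhas x).tsum_eq).symm) hbound hα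

/-- **`η = 0` in `x`-space for all sufficiently large `d`, from `HvdH2017_prop88` and the
two-long-lines bound (§3.5) for all large `d`** — the interface for a per-`d` proof of Hara's
two-long-lines estimate with a geometric rate (e.g. `2Δ̃_{p_c}Δ_{p_c}`, small for large `d` by
`two_mul_percTriTildeBar_mul_percTriBar_lt_one_of_prop88`): the summability of the diagrams is
`tsum_tsum_piNDiagramPc_ne_top_of_prop88`, Lemma 1.5 is `lemma15At_of_twoLongLinesAt`, and the
rest is `exists_etaZeroXSpace_largeD`.
[cite: Hara2008, Thm. 1.1, §1.2, Lemma 1.5 and §3.5] [cite: HeydenreichVanDerHofstad2017, Prop. 8.8, Cor. 8.13 and Thm. 11.4] -/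
theorem exists_etaZeroXSpace_largeD_of_twoLongLinesAt (h88 : HvdH2017_prop88)
    (hL : ∃ d₁ : ℕ, ∀ d : ℕ, d₁ ≤ d → ∃ C q : ℝ, 0 < q ∧ q < 1 ∧
      ∀ (N : ℕ), 1 ≤ N → ∀ (x : Site d) (b : ℝ), x ≠ 0 →
        (∀ y : Site d, euclidNorm x / (2 * N + 1) - 1 ≤ euclidNorm y →
          tau d (criticalProbI d) 0 y ≤ b) →
        piNDiagramPc d N x ≤ ENNReal.ofReal (C * ((N : ℝ) + 1) ^ 2 * q ^ N * b ^ 2)) :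
    ∃ d₀ : ℕ, ∀ d : ℕ, d₀ ≤ d → EtaZeroXSpace d := by
  obtain ⟨dT, hT⟩ := tsum_tsum_piNDiagramPc_ne_top_of_prop88 h88
  obtain ⟨d₁, hL⟩ := hL
  refine exists_etaZeroXSpace_largeD h88 ⟨max (max dT d₁) 11, fun d hd => ?_⟩
  have hdT : dT ≤ d := le_trans (le_max_left _ _) (le_trans (le_max_left _ _) hd)
  have hd₁ : d₁ ≤ d := le_trans (le_max_right _ _) (le_trans (le_max_left _ _) hd)
  have hd11 : 11 ≤ d := le_trans (le_max_right _ _) hd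
  exact lemma15At_of_twoLongLinesAt hd11 (hT d hdT) (hL d hd₁)

end Literature.Barriers.CriticalPhenomena

end
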